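import Literature.IUT.HodgeTheaters.GlobalFrobenioidsCoricRigidityCanonicalLevels
import HarnessLib

/-!
# [IUTchI] Example 5.1 (v), pp. 127–128: the boxed uniqueness for BOTH pairs with every hypothesis an elementary
# statement about the field of rational functions `K_rat` with its `π₁^rat(†𝒟^⊛)`-action (proof-only)

S. Mochizuki, *Inter-universal Teichmüller theory I*, kurims manuscript (May 2020), §5 Example 5.1 (v), p. 128
l. 49–54 ([IUTchI] Ex 5.1 (v) p.128) [claim: Mochizuki2012, status: disputed]: "`†ℱ^⊛` always admits an ∞κ-coric
(respectively, ∞κ×-coric) structure, which is, moreover, unique up to a uniquely determined isomorphism".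
LANA §6.1 pp. 31–32 [LANA2026Report].

Sub-DAG `plan/L5/SUBDAG-IUTchI-Ex51.md` row E51/L29 (both halves); GAP-LEDGER G-w4d056-2; node IUTchI:Ex5.1(v).
PROOF-ONLY: no definition, no instance, no new `Prop` fact.

**State before this file.**  abc-iut-w4-d056's `existsUniqueCoricStructure_infκPair_canonical` /
`…_infκxPair_canonical` (p436285) still carry three "plumbing" binders: a units action
`[MulDistribMulAction π₁^rat K_rat^×]` with its compatibility `hcoe`, and `[RootableBy K_rat^× ℕ]`.

**What this file proves** (`NFBridgeRecon.existsUniqueCoricStructure_infκPair_fieldLevel`, `…_infκxPair_fieldLevel`):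
the SAME conclusions with those binders DISCHARGED inside the proof — the units action is Mathlib's
`Units.mulDistribMulActionRight` (compatible with the field action by `rfl`), rootability of `K_rat^×` is derived
from the field-level statement "every nonzero rational function has an `n`-th root for every `n ≥ 1`"
(`rootableByOfPowLeftSurj`), and the Kummer-injectivity law (iv) is read at field level.  FINAL HYPOTHESES, all
about `N.Krat` with its `N.piRat`-action and the pseudo-monoid `𝕄^⊛_∞κ` (resp. `𝕄^⊛_∞κ×`): `hroot`, `hprim`
(`K_rat = L̄_C` algebraically closed), `h1`, `hpow` (Rmk 3.1.7 (ii) "divisible"), (iv) `hdiv` (no nonzero rational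
function other than `1` fixed by an open normal subgroup `H` of `π₁^rat` has `H`-fixed `n`-th roots for all `n` —
E51/L26, Kummer theory of the finite levels), (o) `hordmul` (`ord_x` additive on `π₁^rat`-fixed nonzero rational
functions), Rmk 3.1.7 (i)/(ii) `hpole`/`hex`.  No side is taken on [IUTchIII] Cor. 3.12; nothing of the disputed
series is asserted; typed ≠ proved.
-/

namespace Literature.IUT.HodgeTheaters

open ProfiniteGrp ProfiniteGrp.ProfiniteCompletion
open Literature.AnabelianGeometry.EtaleTheta

namespace NFBridgeRecon

variable (N : NFBridgeRecon.{0})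

/-- Field-level Kummer injectivity (iv) implies the units-level form used by the closers (for Mathlib's units
action `Units.mulDistribMulActionRight`). ([IUTchI] Ex 5.1 (v) p.127) [claim: Mochizuki2012, status: disputed] -/
theorem hdiv_units_of_field
    (hdiv : ∀ (H : OpenNormalSubgroup N.piRat) (a : N.Krat), a ≠ 0 → (∀ h : N.piRat, h ∈ H → h • a = a) →
      (∀ n : ℕ+, ∃ b : N.Krat, (∀ h : N.piRat, h ∈ H → h • b = b) ∧ b ^ (n : ℕ) = a) → a = 1)
    (H : OpenNormalSubgroup N.piRat) (a : N.Kratˣ)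
    (ha : letI : MulDistribMulAction N.piRat N.Kratˣ := Units.mulDistribMulActionRight
      a ∈ invariants (A := N.Kratˣ) (H : Subgroup N.piRat))
    (hroots : letI : MulDistribMulAction N.piRat N.Kratˣ := Units.mulDistribMulActionRight
      ∀ n : ℕ+, ∃ b ∈ invariants (A := N.Kratˣ) (H : Subgroup N.piRat), b ^ (n : ℕ) = a) :
    a = 1 := by
  letI : MulDistribMulAction N.piRat N.Kratˣ := Units.mulDistribMulActionRight
  refine Units.ext (hdiv H a a.ne_zero (fun h hh => ?_) (fun n => ?_))
  · exact congrArg Units.val (ha ⟨h, hh⟩)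
  · obtain ⟨b, hb, hbn⟩ := hroots n
    exact ⟨b, fun h hh => congrArg Units.val (hb ⟨h, hh⟩), by rw [← Units.val_pow_eq_pow_val, hbn]⟩

/-- **[IUTchI] Ex. 5.1 (v), ∞κ — FIELD-LEVEL FORM**: `ExistsUniqueCoricStructure π₁^rat 𝕄^⊛_∞κ(†𝒟^⊚)` (genuine
Kummer container over all open normal subgroups of `π₁^rat`) from: `hroot` (nonzero rational functions have all
roots), `hprim` (all roots of unity), `h1`/`hpow` (`𝕄^⊛_∞κ` divisible), (iv) `hdiv` (Kummer injectivity at the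
finite levels), (o) `hordmul` (`ord_x` additive on `π₁^rat`-fixed nonzero functions), Rmk 3.1.7 (i)/(ii)
`hpole`/`hex`.  PROVED; no instance atoms, no container/realisation data, no Ẑ^×-element, no law (a)/(b′).
([IUTchI] Ex 5.1 (v) p.128) [claim: Mochizuki2012, status: disputed] -/
theorem existsUniqueCoricStructure_infκPair_fieldLevel
    (hroot : ∀ a : N.Krat, a ≠ 0 → ∀ n : ℕ, 0 < n → ∃ b : N.Krat, b ^ n = a)
    (hprim : ∀ n : ℕ, 0 < n → ∃ ζ : N.Krat, IsPrimitiveRoot ζ n)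
    (h1 : (1 : N.Krat) ∈ N.Minfκ) (hpow : ∀ (f : N.Krat) (n : ℕ), 0 < n → (f ∈ N.Minfκ ↔ f ^ n ∈ N.Minfκ))
    (hdiv : ∀ (H : OpenNormalSubgroup N.piRat) (a : N.Krat), a ≠ 0 → (∀ h : N.piRat, h ∈ H → h • a = a) →
      (∀ n : ℕ+, ∃ b : N.Krat, (∀ h : N.piRat, h ∈ H → h • b = b) ∧ b ^ (n : ℕ) = a) → a = 1)
    {X : Type*} (ord : X → N.Krat → ℤ)
    (hordmul : ∀ (x : X) (a b : N.Krat), a ≠ 0 → b ≠ 0 → (∀ g : N.piRat, g • a = a) → (∀ g : N.piRat, g • b = b) →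
      ord x (a * b) = ord x a + ord x b)
    (hpole : ∀ f' ∈ N.Minfκ, (∀ g : N.piRat, g • f' = f') →
      ∀ x₁ x₂ : X, x₁ ≠ x₂ → ¬ (ord x₁ f' < 0 ∧ ord x₂ f' < 0))
    (hex : ∃ f ∈ N.Minfκ, (∀ g : N.piRat, g • f = f) ∧
      ∃ x₁ x₂ : X, x₁ ≠ x₂ ∧ 0 < ord x₁ f ∧ 0 < ord x₂ f) :
    ExistsUniqueCoricStructure N.piRat N.infκPair := by
  letI : MulDistribMulAction N.piRat N.Kratˣ := Units.mulDistribMulActionRight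
  letI : RootableBy N.Kratˣ ℕ := rootableByOfPowLeftSurj N.Kratˣ ℕ fun {n} hn a => by
    obtain ⟨b, hb⟩ := hroot (a : N.Krat) a.ne_zero n (Nat.pos_of_ne_zero hn)
    have hb0 : b ≠ 0 := fun h0 => a.ne_zero (by rw [← hb, h0, zero_pow hn])
    exact ⟨Units.mk0 b hb0, Units.ext (by rw [Units.val_pow_eq_pow_val, Units.val_mk0, hb])⟩
  exact N.existsUniqueCoricStructure_infκPair_canonical (fun _ _ => rfl) hprim h1 hpow
    (fun H a ha hroots => N.hdiv_units_of_field hdiv H a ha hroots) ord hordmul hpole hex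

/-- **[IUTchI] Ex. 5.1 (v), "respectively, ∞κ×" — FIELD-LEVEL FORM**: `ExistsUniqueCoricStructure π₁^rat
𝕄^⊛_∞κ×(†𝒟^⊚)` from the same elementary hypotheses on `𝕄^⊛_∞κ×`.  PROVED. ([IUTchI] Ex 5.1 (v) p.128)
[claim: Mochizuki2012, status: disputed] -/
theorem existsUniqueCoricStructure_infκxPair_fieldLevel
    (hroot : ∀ a : N.Krat, a ≠ 0 → ∀ n : ℕ, 0 < n → ∃ b : N.Krat, b ^ n = a)
    (hprim : ∀ n : ℕ, 0 < n → ∃ ζ : N.Krat, IsPrimitiveRoot ζ n)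
    (h1 : (1 : N.Krat) ∈ N.Minfκx) (hpow : ∀ (f : N.Krat) (n : ℕ), 0 < n → (f ∈ N.Minfκx ↔ f ^ n ∈ N.Minfκx))
    (hdiv : ∀ (H : OpenNormalSubgroup N.piRat) (a : N.Krat), a ≠ 0 → (∀ h : N.piRat, h ∈ H → h • a = a) →
      (∀ n : ℕ+, ∃ b : N.Krat, (∀ h : N.piRat, h ∈ H → h • b = b) ∧ b ^ (n : ℕ) = a) → a = 1)
    {X : Type*} (ord : X → N.Krat → ℤ)
    (hordmul : ∀ (x : X) (a b : N.Krat), a ≠ 0 → b ≠ 0 → (∀ g : N.piRat, g • a = a) → (∀ g : N.piRat, g • b = b) →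
      ord x (a * b) = ord x a + ord x b)
    (hpole : ∀ f' ∈ N.Minfκx, (∀ g : N.piRat, g • f' = f') →
      ∀ x₁ x₂ : X, x₁ ≠ x₂ → ¬ (ord x₁ f' < 0 ∧ ord x₂ f' < 0))
    (hex : ∃ f ∈ N.Minfκx, (∀ g : N.piRat, g • f = f) ∧
      ∃ x₁ x₂ : X, x₁ ≠ x₂ ∧ 0 < ord x₁ f ∧ 0 < ord x₂ f) :
    ExistsUniqueCoricStructure N.piRat N.infκxPair := by
  letI : MulDistribMulAction N.piRat N.Kratˣ := Units.mulDistribMulActionRight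
  letI : RootableBy N.Kratˣ ℕ := rootableByOfPowLeftSurj N.Kratˣ ℕ fun {n} hn a => by
    obtain ⟨b, hb⟩ := hroot (a : N.Krat) a.ne_zero n (Nat.pos_of_ne_zero hn)
    have hb0 : b ≠ 0 := fun h0 => a.ne_zero (by rw [← hb, h0, zero_pow hn])
    exact ⟨Units.mk0 b hb0, Units.ext (by rw [Units.val_pow_eq_pow_val, Units.val_mk0, hb])⟩
  exact N.existsUniqueCoricStructure_infκxPair_canonical (fun _ _ => rfl) hprim h1 hpow
    (fun H a ha hroots => N.hdiv_units_of_field hdiv H a ha hroots) ord hordmul hpole hex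

end NFBridgeRecon

end Literature.IUT.HodgeTheaters
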